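import Mathlib
import Summits.Schanuel.Schanuel.Theses.RigidCore
import Literature.NumberTheory.Transcendental.ExpPointsShapiroModel

/-!
# Sketch — first lemmas of the crux-idea cards for `RigidCore.SparsityTwo` (stmt-Schanuel-0971)

Card `galois-norm-branch-defect`: `NormDescentTwo` (d = 2 engine = Theorem P without Pell orbits),
`NormDescentThree` (d = 3 transfer to simultaneous approximation), `ShapiroModelFinite` (first
application: the disprover's calibration instance, unconditionally).
Card `puncture-log-analytic-rigidity`: `LogAnalyticGermRigidity` (the definability-free
replacement for o-minimal finiteness of the modulus set at a place at infinity).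
-/

namespace Summit.Schanuel.Schanuel.Cruxes.SparsityTwo.Sketch

open scoped Real

/-- Card A, first lemma (d = 2 engine). For a real quadratic irrational `β` (β² = bβ + c over ℤ)
and a real constant `τ` with `τ(2β - b)` irrational (in the application `τ = a₁/π²`-type, so this
is Lindemann) or `τ = 0`, only finitely many integer pairs `(M, N)`, `M ≠ 0`, satisfy the
second-order hit condition `|M (N - βM) - τ| ≤ C/M²`: the norm `n = (N - βM)(N - β'M) ∈ ℤ`
converges to `τ(2β - b) ∉ ℤ` (resp. to `0` with `n ≠ 0`). -/
def NormDescentTwo : Prop :=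
  ∀ (b c : ℤ) (β τ C : ℝ), β ^ 2 = b * β + c → Irrational β →
    (Irrational (τ * (2 * β - b)) ∨ τ = 0) →
    Set.Finite {p : ℤ × ℤ | p.1 ≠ 0 ∧
      |(p.1 : ℝ) * ((p.2 : ℝ) - β * p.1) - τ| ≤ C / (p.1 : ℝ) ^ 2}

/-- Card A, first lemma (d = 3 transfer). For a real cubic `β` (β³ = bβ² + cβ + e over ℤ) the
second-order hit condition forces a SECOND approximation: the integer norm
`n = N_{ℚ(β)/ℚ}(N - βM)` satisfies `|n - τ f'(β) M| ≤ C'/|M|`, i.e. `M` is simultaneously a good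
denominator of `β` and of `κ := τ f'(β)` (transcendental in the application). -/
def NormDescentThree : Prop :=
  ∀ (b c e : ℤ) (β τ C : ℝ), β ^ 3 = b * β ^ 2 + c * β + e →
    ∃ C' : ℝ, ∀ M N : ℤ, M ≠ 0 →
      |(M : ℝ) * ((N : ℝ) - β * M) - τ| ≤ C / (M : ℝ) ^ 2 →
        ∃ n : ℤ, |(n : ℝ) - τ * (3 * β ^ 2 - 2 * b * β - c) * M| ≤ C' / |(M : ℝ)|

/-- Card A, the residual atom statement for d = 3 in its cleanest form (the Transfer target C⁺ on
the cubic torsion atom): simultaneous approximation of `(β, κ)` at the scale `1/M` in BOTH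
coordinates happens only finitely often. Metrically true (∑ 1/M² < ∞); open for the specific
`κ ∈ ℚ(β)^× · π⁻²`. -/
def SimFinite (β κ C : ℝ) : Prop :=
  Set.Finite {M : ℤ | ∃ N n : ℤ, |(N : ℝ) - β * M| ≤ C / |(M : ℝ)| ∧ |(n : ℝ) - κ * M| ≤ C / |(M : ℝ)|}

/-- Card A, first application: the disprover's calibration instance
(`Literature.NumberTheory.Transcendental.shapiroModel_finite_of_sparsity` derives it FROM the crux)
is a theorem on its own by `NormDescentTwo` with `β = √2`, `τ = -√2/π²`
(numerics: `compute/norm_descent_check.py`, the would-be integer `N'² - 2M²` tends to `-4/π²`). -/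
def ShapiroModelFinite : Prop :=
  Set.Finite {t : ℂ | t ≠ 0 ∧ (1 - t) * Complex.exp t = 1 + t ∧
    (1 - (Real.sqrt 2 : ℂ) * t) * Complex.exp ((Real.sqrt 2 : ℂ) * t) = 1 + (Real.sqrt 2 : ℂ) * t}

/-- Card B, first lemma (log-analytic germ rigidity): a real-analytic germ in two variables,
evaluated along the transcendental arc `(r, r log r)`, `r → 0⁺`, is either identically zero or
eventually zero-free (leading term `r^{n₀} P_{n₀}(log r)` of the rearranged expansion dominates).
This replaces o-minimality of `ℝ_{an,exp}` in the finiteness of the modulus set near a place at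
infinity of `W̄`. -/
def LogAnalyticGermRigidity : Prop :=
  ∀ H : ℝ × ℝ → ℝ, AnalyticAt ℝ H (0, 0) →
    (∃ ε > 0, ∀ r ∈ Set.Ioo (0 : ℝ) ε, H (r, r * Real.log r) = 0) ∨
    (∃ ε > 0, ∀ r ∈ Set.Ioo (0 : ℝ) ε, H (r, r * Real.log r) ≠ 0)

/-- Shape of both lines: everything but the atoms is provable, and the crux follows from an explicit
atom statement. (Placeholder composition target; `AtomFiniteness` is NOT defined here — crux-plan
stage.) -/
example : Summit.Schanuel.Schanuel.Theses.RigidCore.SparsityTwo →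
    ShapiroModelFinite := fun hS =>
  Literature.NumberTheory.Transcendental.shapiroModel_finite_of_sparsity
    (fun W hW hd => hS W hW hd)

end Summit.Schanuel.Schanuel.Cruxes.SparsityTwo.Sketch
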